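import Summits.Ventures.PercRepro.PerFlatHall
import Summits.Ventures.PercRepro.PerLineClosingB
import Summits.Ventures.PercRepro.RankLevelSetN

/-!
# PercRepro — the Hall form of C-025 (C-029) at `q = 2` on the core, for every `p ≥ 4` (night-4, gen 2)

Theorem N (p2's `PairWeighting` / `PerLineClosing(B)`) proves the rows `(p, 2)` by the PAIR RULE on the lines of a
simple matroid: `S` pays the line `L` the weight `w(L, S) = C(|S ∩ L|, 2)/C(|S|, 2)` when the trace `S ∩ L` is
eligible (at least two points and a coindependent pair), `Σ_L w(L, S) ≤ 1` (`sum_w_le_one`), and on every line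
`Φ(p, 2) · #U′_L ≤ Σ_{B ∈ Elig(L)} F_{n′}(|B|) ≤ supply(L) = Σ_{S ∈ Y′} w(L, S)` (`perLine_closing′`, `supply_ge`).
An eligible trace has two points, hence rank `2` in a simple matroid, so the pair rule is supported on adjacency:
it is a certificate in the sense of `PerFlatHall.lean`, and **`hall_q_two_core`**: `Hall M p 2 (Φ(p, 2))` on every
simple matroid of rank `≥ p ≥ 4`, coloop-free at rank `p` — C-029 at `q = 2` on the core.  Imports `PerFlatHall`,
`PerLineClosingB`, `RankLevelSetN`.
-/

namespace PercRepro.PerFlat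

open Finset ThmH ThmN

variable {α : Type*} [DecidableEq α] {M : Matroid α} [M.Finite]

omit [DecidableEq α] in
/-- The middle level `Yq M p 2` is Theorem N's `Y′`. -/
theorem Yq_two_eq_Yp (p : ℕ) : Yq M p 2 = Yp M p := by
  ext S
  unfold Yq Yp
  rw [Finset.mem_filter, Finset.mem_filter]
  rfl

/-- The bottom sets of a line are among Theorem N's `U′_L`. -/
theorem UqG_two_subset_UpL (p : ℕ) (L : Finset α) : UqG M p 2 L ⊆ UpL M p L := by
  intro B hB
  unfold UqG at hB
  rw [Finset.mem_filter, mem_Uq] at hB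
  obtain ⟨⟨-, hr, hc⟩, hBL⟩ := hB
  unfold UpL
  rw [Finset.mem_filter, Finset.mem_powerset]
  refine ⟨hBL, ?_, by rw [hc]⟩
  have := M.eRk_le_encard (B : Set α)
  rw [hr, Set.encard_coe_eq_coe_finsetCard] at this
  exact_mod_cast this

/-- The pair rule vanishes off adjacency on a line: an eligible trace has two points of the line, hence rank `2`. -/
theorem w_eq_zero_of_not_adj (hs : Simple M) (p : ℕ) {L S : Finset α} (hL : L ∈ lines M)
    (h : ¬ Adj M 2 L S) : w M p L S = 0 := by
  classical
  unfold w
  rw [if_neg]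
  intro hE
  apply h
  unfold Adj
  unfold Elig at hE
  rw [Finset.mem_filter, Finset.mem_powerset] at hE
  obtain ⟨hsub, h2, -⟩ := hE
  obtain ⟨a, ha, b, hb, hab⟩ := Finset.one_lt_card.1 (by omega : 1 < (S ∩ L).card)
  have hLg : L ⊆ gr M := (mem_lines.1 hL).1
  have haE : a ∈ M.E := by rw [← coe_gr]; exact_mod_cast hLg (Finset.mem_of_mem_inter_right ha)
  have hbE : b ∈ M.E := by rw [← coe_gr]; exact_mod_cast hLg (Finset.mem_of_mem_inter_right hb)
  have hpair := hs a haE b hbE hab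
  apply le_antisymm
  · have := M.eRk_mono (Finset.coe_subset.2 hsub)
    rw [(mem_lines.1 hL).2.2] at this
    exact this
  · have hsub' : (({a, b} : Finset α) : Set α) ⊆ ((S ∩ L : Finset α) : Set α) := by
      rw [Finset.coe_pair]
      exact Set.insert_subset (Finset.mem_coe.2 ha) (Set.singleton_subset_iff.2 (Finset.mem_coe.2 hb))
    have := M.eRk_mono hsub'
    rw [Finset.coe_pair, hpair] at this
    exact this

/-- **C-029 at `q = 2` on the core**: `Hall M p 2 (Φ(p, 2))` for every simple matroid of rank `≥ p ≥ 4`,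
coloop-free at rank `p` (Theorem N's pair rule is a certificate). -/
theorem hall_q_two_core (hs : Simple M) {p : ℕ} (hp4 : 4 ≤ p) (hpE : ((p : ℕ) : ℕ∞) ≤ M.eRank)
    (hcol : M.eRank = (p : ℕ) → ∀ e, ¬ M.IsColoop e) : Hall M p 2 (phiK p 2) := by
  apply hall_of_cert (by rw [phiK_two_eq]; exact ThmN.phiTwo_nonneg p) (w := w M p)
  refine ⟨fun L S => w_nonneg M p L S, ?_, ?_, ?_⟩
  · intro L hL S h
    rw [flatsQ_two] at hL
    exact w_eq_zero_of_not_adj hs p hL h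
  · intro S _
    rw [flatsQ_two]
    exact sum_w_le_one hs p S
  · intro L hL
    rw [flatsQ_two] at hL
    rw [Yq_two_eq_Yp, phiK_two_eq]
    calc BinomialLayer.phiTwo p * ((UqG M p 2 L).card : ℚ)
        ≤ BinomialLayer.phiTwo p * ((UpL M p L).card : ℚ) := by
          apply mul_le_mul_of_nonneg_left _ (ThmN.phiTwo_nonneg p)
          exact_mod_cast Finset.card_le_card (UqG_two_subset_UpL p L)
      _ ≤ ∑ B ∈ Elig M p L, Fn p (gr M \ L).card B.card := perLine_closing' hs hp4 hpE hcol hL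
      _ ≤ supply M p L := supply_ge hs p hL
      _ = ∑ S ∈ Yp M p, w M p L S := rfl

end PercRepro.PerFlat
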